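import Summits.BirchSwinnertonDyer.BirchSwinnertonDyer.Theses.ErratumRoadFive
import Summits.BirchSwinnertonDyer.BirchSwinnertonDyer.Theorems.ErratumRoadFiveRest3NoWitnessOfFW21IrrKRamFree

/-!
# Line `Lines/ramfree.lean` v1 — crux `ErratumRoadFive.Rest3NoWitnessBranchAtFive` (item stmt-BirchSwinnertonDyer-19703, child (NW) of REST‴ 19624)
# ON THE RAM-FREE ERRATUM ROAD (planner RULING 107, 2026-08-29, ask (T3); bsd-stepL-imc-p1 g34; TURNKEY, NOT KEYED — W-79: the pen keys)

After the RULING 86 (c) ∕ 107 re-key, K2a's deciding open input is the print-faithful crux `ErratumThm23SigmaLeSelfDualIrrK` (F4♯‡: erratum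
Thm. 2.3 «⊂» with (i) `ρ̄|_{G_K}` irreducible and (iii) ∃ `q ∥ M` non-split AS PRINTED — NO residual ramification at `q`). On that road EVERY
(ram) pair with `E(ℚ_p)[p] = 0` and an ODD NON-SPLIT multiplicative `q ≠ p` — `E[p]` ramified at `q` OR NOT — gets its open input from the
ram-free core shape (imc-p1 g32: `P2.imcDivIntCoreFrameAtErratumDataBRamFree_of_thm23SelfDualIrrK_OPEN_of_framesWtRamFree_of_facts`, p695834, +
`KernelFromPrintBRamFree.rest3NoWitnessBranchAtFive_of_print_of_coreBRamFree_of_noOddNonsplit`, p696379). So the (NW) child 19703 — whose TEXT is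
unchanged («(ram), torsion-free at p, NO odd non-split E[p]-RAMIFIED witness») — shrinks on this line to the residual

  «19703‡» `stub_nw_ramFreeResidual` := ∀ W p, Ram W p → (∀ P₀ : E(ℚ_p), p • P₀ = 0 → P₀ = 0) →
      ¬ (∃ q prime, q ≠ 2 ∧ q ≠ p ∧ Mult W q ∧ ¬ Split W q) → P2OpenInputOnTreeAt W p

(the (ram) pairs, torsion-free at `p`, with NO odd non-split multiplicative prime at all — all-split ∕ only-`q = 2`; rest-p2 census: the NEW_A
rows 7 548 pairs leave 19703 for the erratum road, j319451), and `_of` is imc-p1 g32's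
`RamFreeRekey.rest3NoWitnessBranchAtFive_of_thm23SelfDualIrrK_OPEN_of_items` (p697056) with the route ITEMS taken BY NAME exactly as `closes`
(rev 72+) takes them: the new deciding crux `ErratumThm23SigmaLeSelfDualIrrK` (F4♯‡), the new support `ErratumHidaMemberFramesNonsplitWtRamFree`
(F3♯‡ = `Castella2018.erratum_exists_frames_members_sigma_congruence_wt_ramFree`, PUB + Hida bookkeeping), 20495 `JSWSigmaLocalCharIdeal`,
19283 `PublishedInputsIMCReduction`, 19625 `BDPValueContinuityInput`, 19285 `WuthrichShaDividesAnalyticSha`, 19626 `JSWAnticyclotomicControlMult`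
(all unfold definitionally to the Props g32's theorem binds).

Relation to the registered `Lines/birth.lean` v3 (Tamagawa cut: `stub_nw_locus` ⊔ `stub_nw_offLocus`): a DIFFERENT cut of the same crux
(by the presence of an odd non-split multiplicative prime instead of by `p ∣ ∏ c_ℓ`); both lines stay; neither stub of v3 is implied by or
implies «19703‡» class-wide. No summit statement and no crux is proved here; BSD is not advanced by this file.
Stub statements by name: `Statement.stub_*`.

[claim: FouquetWan2021, Thm. 4.41, App. B Cor. 7.21, Lemma 7.22, status: under-review] [claim: Castella2018Erratum, Thm. 1.1, Thm. 2.3, status: under-review]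
[cite: JetchevSkinnerWan2017, Thm. 3.3.1, §5.1, §7.4] [cite: Castella2018Exceptional, Thms. 2.10–2.11] [cite: Wuthrich2014, Prop. 21]
-/

noncomputable section

-- D-0017: single-problem summit, the namespace repeats the problem name by design.
set_option linter.dupNamespace false

open scoped Classical

open WeierstrassCurve
  Literature.NumberTheory.EllipticCurves Literature.NumberTheory.EllipticCurves.Rank1Residual
  Summit.BirchSwinnertonDyer.Rank1Residual Summit.BirchSwinnertonDyer.Rank1Residual.X11b

namespace Summit.BirchSwinnertonDyer.BirchSwinnertonDyer.Cruxes.Rest3NoWitnessBranchAtFive.RamFree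

/- the crux `Rest3NoWitnessBranchAtFive` is the ROUTE decl `Summit.BirchSwinnertonDyer.BirchSwinnertonDyer.Theses.ErratumRoadFive.Rest3NoWitnessBranchAtFive`
   (imported), concluded BY NAME below. -/

/-! ## Registered stubs -/

/-- **«19703‡» · `stub_nw_ramFreeResidual` — THE ONE GENUINE STUB: the open input `P2OpenInputOnTreeAt W p` at every (ram) pair that is
torsion-free at `p` (`E(ℚ_p)[p] = 0`) and has NO odd non-split multiplicative prime `q ≠ p` at all** (all other multiplicative primes split, or
the only non-split one is `2`). = binder `hrest` of `RamFreeRekey.rest3NoWitnessBranchAtFive_of_thm23SelfDualIrrK_OPEN_of_items` (imc-p1 g32,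
p697056) VERBATIM. No road in print or preprint: the erratum ∕ [FW21 4.41] need a non-split `q ∥ M` in `K` at which `E` is non-split
multiplicative (rigidity of automorphic types), the Kolyvagin road needs [SZ14 Thm. 1.1] (preprint) on its Locus part.
[cite: Castella2018Erratum, Thm. 1.1 (iii) (p. 1), footnote 1 (p. 4)] [cite: SkinnerZhang2014, Thm. 1.1] -/
theorem stub_nw_ramFreeResidual :
    ∀ (W : WeierstrassCurve ℚ) [W.IsElliptic] [W.IsGloballyMinimal] (p : ℕ) [Fact p.Prime],
      Ram W p → (∀ P₀ : (W.baseChange ℚ_[p]).toAffine.Point, p • P₀ = 0 → P₀ = 0) →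
      ¬ (∃ (q : ℕ) (_ : Fact q.Prime), q ≠ 2 ∧ q ≠ p ∧ Mult W q ∧
          ¬ W.HasSplitMultiplicativeReductionAtPrime q) →
      P2OpenInputOnTreeAt W p := by
  sorry

/-! ## Stub statements by name -/

namespace Statement

/-- Statement of `stub_nw_ramFreeResidual` («19703‡», the ram-free residual of the (NW) child). -/
abbrev stub_nw_ramFreeResidual : Prop := type_of% @RamFree.stub_nw_ramFreeResidual

end Statement

/-! ## The composition (sorry-free): the stub STATEMENT and the route ITEMS imply the crux, BY NAME -/

/-- **`Rest3NoWitnessBranchAtFive_of`** (ramfree v1) — the crux BY NAME from «19703‡» + the re-keyed route ITEMS taken BY NAME (each unfolds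
definitionally to the `Prop` bound by g32's theorem): `h23` = the deciding crux `ErratumThm23SigmaLeSelfDualIrrK` (F4♯‡), `hMF` = support
`ErratumHidaMemberFramesNonsplitWtRamFree` (F3♯‡), `hloc` = 20495 `JSWSigmaLocalCharIdeal`, `hF` = 19283 `PublishedInputsIMCReduction`,
`hVN` = 19625 `BDPValueContinuityInput`, `hWu` = 19285 `WuthrichShaDividesAnalyticSha`, `h331` = 19626 `JSWAnticyclotomicControlMult`; the
composition is `RamFreeRekey.rest3NoWitnessBranchAtFive_of_thm23SelfDualIrrK_OPEN_of_items` (p697056: ram-free Road FF at every pair +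
`KernelFromPrintBRamFree`). Pure logic here. [cite: Castella2018Erratum, Thm. 1.1 (iii), Thm. 2.3 (i)–(iv), (2.4)–(2.5) (pp. 1–4)]
[cite: JetchevSkinnerWan2017, Thm. 3.3.1, §5.1] -/
theorem Rest3NoWitnessBranchAtFive_of
    (h23 : Summit.BirchSwinnertonDyer.BirchSwinnertonDyer.Theses.ErratumRoadFive.ErratumThm23SigmaLeSelfDualIrrK)
    (hMF : Summit.BirchSwinnertonDyer.BirchSwinnertonDyer.Theses.ErratumRoadFive.ErratumHidaMemberFramesNonsplitWtRamFree)
    (hloc : Summit.BirchSwinnertonDyer.BirchSwinnertonDyer.Theses.ErratumRoadFive.JSWSigmaLocalCharIdeal)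
    (hF : Summit.BirchSwinnertonDyer.BirchSwinnertonDyer.Theses.ErratumRoadFive.PublishedInputsIMCReduction)
    (hVN : Summit.BirchSwinnertonDyer.BirchSwinnertonDyer.Theses.ErratumRoadFive.BDPValueContinuityInput)
    (hWu : Summit.BirchSwinnertonDyer.BirchSwinnertonDyer.Theses.ErratumRoadFive.WuthrichShaDividesAnalyticSha)
    (h331 : Summit.BirchSwinnertonDyer.BirchSwinnertonDyer.Theses.ErratumRoadFive.JSWAnticyclotomicControlMult)
    (h1 : Statement.stub_nw_ramFreeResidual) :
    Summit.BirchSwinnertonDyer.BirchSwinnertonDyer.Theses.ErratumRoadFive.Rest3NoWitnessBranchAtFive :=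
  Summit.BirchSwinnertonDyer.BirchSwinnertonDyer.Theorems.RamFreeRekey.rest3NoWitnessBranchAtFive_of_thm23SelfDualIrrK_OPEN_of_items
    h23 hMF hloc hF hVN hWu h331 h1

/-- The crux along this line — ramfree v1: MODULO the seven route items (binders, exactly as `closes` takes them) and exactly the ONE
registered genuine stub (the only `sorry` lives in `stub_nw_ramFreeResidual`). -/
theorem Rest3NoWitnessBranchAtFive_proof
    (h23 : Summit.BirchSwinnertonDyer.BirchSwinnertonDyer.Theses.ErratumRoadFive.ErratumThm23SigmaLeSelfDualIrrK)
    (hMF : Summit.BirchSwinnertonDyer.BirchSwinnertonDyer.Theses.ErratumRoadFive.ErratumHidaMemberFramesNonsplitWtRamFree)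
    (hloc : Summit.BirchSwinnertonDyer.BirchSwinnertonDyer.Theses.ErratumRoadFive.JSWSigmaLocalCharIdeal)
    (hF : Summit.BirchSwinnertonDyer.BirchSwinnertonDyer.Theses.ErratumRoadFive.PublishedInputsIMCReduction)
    (hVN : Summit.BirchSwinnertonDyer.BirchSwinnertonDyer.Theses.ErratumRoadFive.BDPValueContinuityInput)
    (hWu : Summit.BirchSwinnertonDyer.BirchSwinnertonDyer.Theses.ErratumRoadFive.WuthrichShaDividesAnalyticSha)
    (h331 : Summit.BirchSwinnertonDyer.BirchSwinnertonDyer.Theses.ErratumRoadFive.JSWAnticyclotomicControlMult) :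
    Summit.BirchSwinnertonDyer.BirchSwinnertonDyer.Theses.ErratumRoadFive.Rest3NoWitnessBranchAtFive :=
  Rest3NoWitnessBranchAtFive_of h23 hMF hloc hF hVN hWu h331 stub_nw_ramFreeResidual

end Summit.BirchSwinnertonDyer.BirchSwinnertonDyer.Cruxes.Rest3NoWitnessBranchAtFive.RamFree

end
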